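import Summits.FinalStateConjecture.FinalStateConjecture.Theorems.ZeroEnergyKerrOrBombStationaryLimitReductionRecutCoveringJunctionCore
import Summits.FinalStateConjecture.FinalStateConjecture.Theorems.ZeroEnergyKerrOrBombStationaryLimitReductionStubChartTransfer
import Literature.Geometry.Lorentzian.KerrSchildFrame
import Literature.Geometry.Lorentzian.KerrFluxComparison
import HarnessLib

/-!
# Route ZeroEnergyKerrOrBomb · crux `FinalStateFromKerrOrBomb` (stmt-FinalStateConjecture-17839), line
# `SketchIdeator1` — stub `stub_recutJunctionCoreCO`, wave 5: the Kerr–Schild time-function property (HTF) of the old chart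
# near the horizon, from `junctionTimeFunction_boostedKerr`

Helper file (`--supports stmt-FinalStateConjecture-17839`; registered helper `recutJunction_timeFunction_nearHorizon`) of the
lead's wave-5 stub worker W16 (2026-08-17); it discharges the hypothesis (HTF) of `recutJunction_nearHorizon_of_timeFunction`
(…RecutCoreCONearHorizon, proposed the same day) from the registered brick `junctionTimeFunction_boostedKerr` (p138474, unbuilt:
taken as a HYPOTHESIS, verbatim), the near-zone `C²` convergence of the old chart on the growing slabs, the Kerr identification
(`cᵢ = 1`), its future-preservation (F5) and the orientation clause (ii) of `IsOrientationCompatible`.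

(HTF) for hole `i`: there are `T₁, δ₀ > 0` such that along every future causal curve `γ` of `𝓢` running in the old chart
images of Kerr–Schild points with `t* ≥ T₁`, `r ≤ r₊ + δ₀`, the Kerr–Schild time of the (late) Kerr–Schild labels of its points is
nondecreasing. Proof: the recut chart `ψ' = ψᵢ ∘ Pᵢ ∘ Θᵢ ∘ Pᵢ⁻¹` is a late chart (`isLateChart_recut`); on
`S := {t* ≥ T₁, r ≤ r₊ + 1}` its deviation from boosted Kerr is `≤ 1/(100‖Λ‖²)` (L1 `recutGrowingTransfer`, p124807, built) and
`dψ'(Λ V)` is future-directed (chain rule `dψ'(Λ V) = dψᵢ(Λ dΘᵢ V)`, timelike by pinching since `g_{M,a}(V,V) = −1 − 2H` and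
`‖Λ V‖ ≤ 5‖Λ‖`, future by (F5) + (ii)); `junctionTimeFunction_boostedKerr` concludes.

Elementary; no named fact, nothing restated. Reference: Dafermos–Rodnianski arXiv:0811.0354, §5.1 (`t*` is a time function);
Dafermos–Luk arXiv:1710.01722, Conjecture 1 (b)–(c).
-/

set_option linter.dupNamespace false

noncomputable section

open scoped Manifold ContDiff Topology ENNReal
open Set Filter Function

namespace Summit.FinalStateConjecture.FinalStateConjecture.Theorems.SymplecticDualOfTheBomb

open Literature.Geometry.Lorentzian Summit.FinalStateConjecture.FinalStateConjecture.Theorems.OneLockedExplosion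

section Prelim

variable (𝓢 : Spacetime.{0} 4) (B : ModelBackground)

/-- Private copy of `norm_deviation_lt_of_truncDeviationCk_lt` (…JunctionTimeFunction, unbuilt today): `C⁰`-closeness on a
truncated slab is pointwise closeness. [folklore] -/
private theorem norm_deviation_lt_w5t (ψ : B.domain → 𝓢.carrier) {k : ℕ} {R τ ε : ℝ} (hε : 0 < ε)
    (h : 𝓢.truncDeviationCk B ψ k R τ < ENNReal.ofReal ε) {x : B.domain} (hx : x ∈ B.truncTimeSlab R τ) :
    ‖𝓢.deviation B ψ x‖ < ε := by
  have h2 := enorm_iteratedFDeriv_le_supCkENorm (Nat.zero_le k) (mem_image_of_mem Subtype.val hx) (𝓢.deviationExtend B ψ)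
  rw [← ofReal_norm, norm_iteratedFDeriv_zero, 𝓢.deviationExtend_coe] at h2
  exact (ENNReal.ofReal_lt_ofReal_iff hε).1 (h2.trans_lt h)

/-- Private copy of `norm_timeVector_le` (…ChartTransferT2, unbuilt today): `‖V_{M,a}(u)‖ ≤ 5` on the sub-extremal Kerr
exterior. Dafermos–Rodnianski arXiv:0811.0354, §5.1. [folklore] -/
private theorem norm_timeVector_le_w5t {M a : ℝ} (hMa : Kerr.IsSubextremal M a) {u : E4}
    (hu : u ∈ (Kerr.exterior M a : Set E4)) : ‖Kerr.timeVector M a u‖ ≤ 5 := by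
  have hr : 0 < Kerr.radius a u := Kerr.radius_pos_of_mem_region hu
  have hH0 : 0 ≤ Kerr.scalarH M a u := Kerr.scalarH_nonneg hMa.pos.le a u
  have hH1 : Kerr.scalarH M a u ≤ 1 := Kerr.scalarH_le_one hMa hu
  have hℓ : ‖Kerr.nullVector a u‖ ≤ 2 := by nlinarith [Kerr.norm_nullVector_sq hr (a := a), norm_nonneg (Kerr.nullVector a u)]
  have h4 : ‖E4.basisVector 0‖ = 1 := by simp [E4.basisVector]
  calc ‖Kerr.timeVector M a u‖ ≤ ‖E4.basisVector 0‖ + ‖(2 * Kerr.scalarH M a u) • Kerr.nullVector a u‖ := norm_sub_le _ _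
    _ = 1 + 2 * Kerr.scalarH M a u * ‖Kerr.nullVector a u‖ := by
        rw [h4, norm_smul, Real.norm_eq_abs, abs_of_nonneg (by linarith)]
    _ ≤ 5 := by nlinarith

end Prelim

set_option maxHeartbeats 400000 in
/-- **Registered helper `recutJunction_timeFunction_nearHorizon`** — the hypothesis (HTF) of `recutJunction_nearHorizon_of_timeFunction`
from `junctionTimeFunction_boostedKerr` (hypothesis, verbatim), the near-zone convergence (i), monotone radii `→ ∞`, the Kerr
identifications with `cᵢ = 1`, their future-preservation (F5) and the orientation clause (ii). [folklore] -/
theorem recutJunction_timeFunction_nearHorizon : ∀ {𝓢 : Spacetime.{0} 4} {O : Set 𝓢.carrier} {k : ℕ} (d : StationaryFinalStateDecomposition 𝓢 O k) (M a c r₀ : Fin d.N → ℝ) (Θ : Fin d.N → E4 → E4) (R : Fin d.N → ℝ → ℝ), (∀ i, Tendsto (fun τ ↦ 𝓢.truncDeviationCk (d.background i) (d.toOver.chart i) 2 (R i τ) τ) atTop (𝓝 0)) → (∀ i, Monotone (R i)) → (∀ i, Tendsto (R i) atTop atTop) → (∀ i, IsKerrChartedWith (d.hole i) (d.adapted i)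 (M i) (a i) (c i) (r₀ i) (Θ i)) → (∀ i, c i = 1) → (∀ i, ∀ u ∈ (Kerr.exterior (M i) (a i) : Set E4), ∀ h : Θ i u ∈ (d.adapted i).domain, (d.hole i).timeOrientation.IsFutureDirected (mfderiv 𝓘(ℝ, E4) (𝓡 4) (d.adapted i).toFun ⟨Θ i u, h⟩ (fderiv ℝ (Θ i) u (Kerr.timeVector (M i) (a i) u)))) → (∀ (i : Fin d.N) (y : (d.background i).domain) (w : E4), d.toOver.τ₀ < (d.background i).time y.1 → (d.hole i).timeOrientation.IsFutureDirected (mfderiv 𝓘(ℝ, E4) (𝓡 4) (d.adapted i).toFun ⟨poincareInv (d.motion i).1 (d.motion i).2 y.1, ModelBackground.mem_boost_domain.1 y.2⟩ (((d.motion i).1 : E4 ≃L[ℝ] E4).symm w)) → 𝓢.metric.IsTimelike (mfderiv 𝓘(ℝ, E4) (𝓡 4) (d.toOver.chart i) y w) → 𝓢.timeOrientation.IsFutureDirected (mfderiv 𝓘(ℝ, E4) (𝓡 4) (d.toOver.chart i) y w)) → (∀ (𝓢 : Spacetime.{0} 4) (Λ : lorentzGroup) (c₀ : E4) (M a : ℝ),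 Kerr.IsSubextremal M a → ∀ (O : Set 𝓢.carrier) (τ₀ : ℝ) (ψ : (boostedKerrBackground Λ c₀ M a).domain → 𝓢.carrier), 𝓢.IsLateChart (boostedKerrBackground Λ c₀ M a) O τ₀ ψ → ∀ (S : Set (boostedKerrBackground Λ c₀ M a).domain), S ⊆ (boostedKerrBackground Λ c₀ M a).lateRegion τ₀ → (∀ x ∈ S, ‖𝓢.deviation (boostedKerrBackground Λ c₀ M a) ψ x‖ ≤ 1 / (100 * ‖((Λ : E4 ≃L[ℝ] E4) : E4 →L[ℝ] E4)‖ ^ 2)) → (∀ x ∈ S, 𝓢.timeOrientation.IsFutureDirected (mfderiv 𝓘(ℝ, E4) (𝓡 4) ψ x ((Λ : E4 ≃L[ℝ] E4) (Kerr.timeVector M a (poincareInv Λ c₀ x.1))))) → ∀ (γ : ℝ → 𝓢.carrier) (a' b' : ℝ), 𝓢.metric.IsFutureCausalCurveOn 𝓢.timeOrientation γ (Set.Icc a' b') → Set.MapsTo γ (Set.Icc a' b') (ψ '' S) → ∀ (s t : ℝ), s ∈ Set.Icc a' b' → t ∈ Set.Icc a' b' → s ≤ t → ∀ (x y : (boostedKerrBackground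 Λ c₀ M a).domain), x ∈ (boostedKerrBackground Λ c₀ M a).lateRegion τ₀ → y ∈ (boostedKerrBackground Λ c₀ M a).lateRegion τ₀ → ψ x = γ s → ψ y = γ t → poincareInv Λ c₀ x.1 0 ≤ poincareInv Λ c₀ y.1 0) → ∀ i : Fin d.N, ∃ T₁ δ₀ : ℝ, 0 < δ₀ ∧ ∀ (γ : ℝ → 𝓢.carrier) (a' b' : ℝ), 𝓢.metric.IsFutureCausalCurveOn 𝓢.timeOrientation γ (Set.Icc a' b') → (∀ s ∈ Set.Icc a' b', ∃ x ∈ (Kerr.exterior (M i) (a i) : Set E4), T₁ ≤ x 0 ∧ Kerr.radius (a i) x ≤ Kerr.rPlus (M i) (a i) + δ₀ ∧ ∃ h₀ : ((d.motion i).1 : E4 ≃L[ℝ] E4) (Θ i x) + (d.motion i).2 ∈ (d.background i).domain, d.toOver.chart i ⟨((d.motion i).1 : E4 ≃L[ℝ] E4) (Θ i x) + (d.motion i).2, h₀⟩ = γ s) → ∀ s ∈ Set.Icc a' b', ∀ t ∈ Set.Icc a' b', s ≤ t → ∀ x ∈ (Kerr.exterior (M i) (a i) : Set E4), ∀ x'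 ∈ (Kerr.exterior (M i) (a i) : Set E4), T₁ ≤ x 0 → T₁ ≤ x' 0 → (∃ h₀ : ((d.motion i).1 : E4 ≃L[ℝ] E4) (Θ i x) + (d.motion i).2 ∈ (d.background i).domain, d.toOver.chart i ⟨((d.motion i).1 : E4 ≃L[ℝ] E4) (Θ i x) + (d.motion i).2, h₀⟩ = γ s) → (∃ h₀' : ((d.motion i).1 : E4 ≃L[ℝ] E4) (Θ i x') + (d.motion i).2 ∈ (d.background i).domain, d.toOver.chart i ⟨((d.motion i).1 : E4 ≃L[ℝ] E4) (Θ i x') + (d.motion i).2, h₀'⟩ = γ t) → x 0 ≤ x' 0 := by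
  intro 𝓢 O k d M a c r₀ Θ R hRi hRmono hRtop hW hc1 hF5 hor₂ hJTF i
  -- data of hole `i`
  obtain ⟨hsub, hc, -, hr₀, hΘs, hinj, hΘm, hΘe, hiso, -⟩ := hW i
  set Λ : lorentzGroup := (d.motion i).1 with hΛ
  set c₀ : E4 := (d.motion i).2 with hc₀
  have hsubreg : (Kerr.exterior (M i) (a i) : Set E4) ⊆ (Kerr.region (a i) (r₀ i) : Set E4) := fun z hz ↦
    Kerr.mem_region.2 ((max_le_max hr₀.le le_rfl).trans_lt (Kerr.mem_exterior.1 hz))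
  have hmaps : MapsTo (recutMap Λ c₀ (Θ i)) ((recutBackground d M a i).domain : Set E4)
      ((d.background i).domain : Set E4) := fun z hz ↦ by
    show poincareInv Λ c₀ ((Λ : E4 ≃L[ℝ] E4) (Θ i (poincareInv Λ c₀ z)) + c₀) ∈ ((d.adapted i).domain : Set E4)
    rw [poincareInv_apply_add]; exact hΘm (hsubreg (mem_boostedKerrExterior.1 hz))
  obtain ⟨L₁, hL₁0, hL₁⟩ := kerrChartedWith_global_bounds (hW i)
  have htilt : ∀ u ∈ (Kerr.exterior (M i) (a i) : Set E4), |Θ i u 0 - u 0| ≤ L₁ := fun u hu ↦ by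
    have h := (hL₁ u hu).1; rwa [hc1 i, one_mul] at h
  -- the recut chart is a late chart for `τ' := τ₀ + L₁`
  set τ' : ℝ := d.toOver.τ₀ + L₁ with hτ'
  have htilt' : ∀ u ∈ (Kerr.exterior (M i) (a i) : Set E4), τ' < u 0 → d.toOver.τ₀ < Θ i u 0 := fun u hu hu0 ↦ by
    have h1 := (abs_le.1 (htilt u hu)).1; linarith
  set ψ' : (recutBackground d M a i).domain → 𝓢.carrier := fun y ↦ d.toOver.chart i ⟨recutMap Λ c₀ (Θ i) y.1, hmaps y.2⟩
    with hψ'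
  have himg : ψ' '' (recutBackground d M a i).lateRegion τ' ⊆ O := by
    rintro _ ⟨y, hy, rfl⟩
    refine (d.toOver.isLateChart i).image_subset ⟨⟨_, hmaps y.2⟩, ?_, rfl⟩
    show d.toOver.τ₀ < (poincareInv Λ c₀ ((Λ : E4 ≃L[ℝ] E4) (Θ i (poincareInv Λ c₀ y.1)) + c₀)) 0
    rw [poincareInv_apply_add]; exact htilt' _ (mem_boostedKerrExterior.1 y.2) hy
  have hlate : 𝓢.IsLateChart (recutBackground d M a i) O τ' ψ' :=
    isLateChart_recut (d.adapted i) Λ c₀ (d.toOver.isLateChart i) hr₀.le hΘs hinj hiso hmaps htilt' himg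
  -- pinching on the growing recut slabs (L1)
  obtain ⟨s₀, hs₀⟩ := recutGrowingTransfer 𝓢 (d.hole i) (d.adapted i) Λ c₀ (M i) (a i) (c i) (r₀ i) (Θ i)
    (d.toOver.chart i) hmaps (R i) (d.toOver.isLateChart i).contMDiff (hW i) (hRmono i) (hRi i)
  have hconv := hs₀ s₀ s₀ le_rfl le_rfl
  set K : ℝ := ‖((Λ : E4 ≃L[ℝ] E4) : E4 →L[ℝ] E4)‖ with hK
  have hK0 : 0 < K := (Λ : E4 ≃L[ℝ] E4).norm_pos
  set ε : ℝ := 1 / (100 * K ^ 2) with hε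
  have hε0 : 0 < ε := by positivity
  have hgrow : Tendsto (fun τ ↦ R i (c i * τ - s₀) - s₀) atTop atTop := by
    have h1 : Tendsto (fun τ ↦ c i * τ - s₀) atTop atTop := by
      rw [hc1 i]; exact tendsto_atTop_atTop.2 fun b ↦ ⟨b + s₀, fun x hx ↦ by linarith⟩
    have h2 := tendsto_atTop_atTop.1 ((hRtop i).comp h1)
    refine tendsto_atTop_atTop.2 fun b ↦ ?_
    obtain ⟨N, hN⟩ := h2 (b + s₀)
    exact ⟨N, fun x hx ↦ by have := hN x hx; simp only [Function.comp] at this; linarith⟩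
  obtain ⟨Td, hTd⟩ := eventually_atTop.1 ((hconv.eventually (gt_mem_nhds (ENNReal.ofReal_pos.2 hε0))).and
    (hgrow.eventually_ge_atTop (Kerr.rPlus (M i) (a i) + 1)))
  set T₁ : ℝ := max Td (τ' + 1) with hT₁
  have hT₁d : Td ≤ T₁ := le_max_left _ _
  have hT₁τ : τ' < T₁ := by have := le_max_right Td (τ' + 1); linarith
  -- the pinched, future-oriented region `S`
  set S : Set (recutBackground d M a i).domain := {y | T₁ ≤ (poincareInv Λ c₀ y.1) 0 ∧
    Kerr.radius (a i) (poincareInv Λ c₀ y.1) ≤ Kerr.rPlus (M i) (a i) + 1} with hS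
  have hSlate : S ⊆ (recutBackground d M a i).lateRegion τ' := fun y hy ↦ by
    show τ' < (poincareInv Λ c₀ y.1) 0; linarith [hy.1]
  have hdev : ∀ y ∈ S, ‖𝓢.deviation (boostedKerrBackground Λ c₀ (M i) (a i)) ψ' y‖ ≤ 1 / (100 * K ^ 2) := fun y hy ↦ by
    obtain ⟨h1, h2⟩ := hTd _ (hT₁d.trans hy.1)
    exact (norm_deviation_lt_w5t 𝓢 _ ψ' hε0 h1 ⟨rfl, hy.2.trans h2⟩).le
  -- chain rule `dψ'(v) = dψᵢ(Λ dΘᵢ (Λ⁻¹ v))`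
  have hΘd : ∀ u ∈ (Kerr.exterior (M i) (a i) : Set E4), DifferentiableAt ℝ (Θ i) u := fun u hu ↦
    (hΘs.differentiableOn (by simp)).differentiableAt ((Kerr.region _ _).isOpen.mem_nhds (hsubreg hu))
  have hΦ : ContDiffOn ℝ ∞ (recutMap Λ c₀ (Θ i)) ((recutBackground d M a i).domain : Set E4) :=
    (contDiffOn_conj Λ c₀ hΘs).mono fun z hz ↦ hsubreg (mem_boostedKerrExterior.1 hz)
  have hchain : ∀ (x : (recutBackground d M a i).domain) (v : E4),
      mfderiv 𝓘(ℝ, E4) (𝓡 4) ψ' x v =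
        mfderiv 𝓘(ℝ, E4) (𝓡 4) (d.toOver.chart i) ⟨recutMap Λ c₀ (Θ i) x.1, hmaps x.2⟩
          ((Λ : E4 ≃L[ℝ] E4) (fderiv ℝ (Θ i) (poincareInv Λ c₀ x.1) ((Λ : E4 ≃L[ℝ] E4).symm v))) := by
    intro x v
    have hd : mfderiv 𝓘(ℝ, E4) (𝓡 4) ψ' x =
        (mfderiv 𝓘(ℝ, E4) (𝓡 4) (d.toOver.chart i) ⟨recutMap Λ c₀ (Θ i) x.1, hmaps x.2⟩).comp
          (mfderiv 𝓘(ℝ, E4) 𝓘(ℝ, E4) (fun y : (recutBackground d M a i).domain ↦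
            (⟨recutMap Λ c₀ (Θ i) y.1, hmaps y.2⟩ : (d.background i).domain)) x) :=
      mfderiv_comp x ((d.toOver.isLateChart i).contMDiff.mdifferentiableAt (by simp))
        ((contMDiff_readapt hmaps hΦ).mdifferentiableAt (by simp))
    rw [hd, mfderiv_readapt hmaps hΦ x]
    show mfderiv 𝓘(ℝ, E4) (𝓡 4) (d.toOver.chart i) ⟨_, hmaps x.2⟩ (fderiv ℝ (fun x ↦ (Λ : E4 ≃L[ℝ] E4)
      (Θ i (poincareInv Λ c₀ x)) + c₀) x.1 v) = _
    rw [fderiv_conj _ _ (hΘd _ (mem_boostedKerrExterior.1 x.2))]; rfl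
  -- `dψ'(Λ V)` is timelike on `S` (pinching) and future-directed ((F5) + (ii))
  have hfut : ∀ y ∈ S, 𝓢.timeOrientation.IsFutureDirected (mfderiv 𝓘(ℝ, E4) (𝓡 4) ψ' y
      ((Λ : E4 ≃L[ℝ] E4) (Kerr.timeVector (M i) (a i) (poincareInv Λ c₀ y.1)))) := fun y hyS ↦ by
    have hu : poincareInv Λ c₀ y.1 ∈ (Kerr.exterior (M i) (a i) : Set E4) := mem_boostedKerrExterior.1 y.2
    have hr : 0 < Kerr.radius (a i) (poincareInv Λ c₀ y.1) := Kerr.radius_pos_of_mem_region hu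
    set w : E4 := (Λ : E4 ≃L[ℝ] E4) (Kerr.timeVector (M i) (a i) (poincareInv Λ c₀ y.1)) with hw
    -- timelike
    have hTL : 𝓢.metric.IsTimelike (mfderiv 𝓘(ℝ, E4) (𝓡 4) ψ' y w) := by
      have hdevy := hdev y hyS
      have h1 : |𝓢.deviation (boostedKerrBackground Λ c₀ (M i) (a i)) ψ' y w w| ≤ 1 / (100 * K ^ 2) * ‖w‖ * ‖w‖ := by
        rw [← Real.norm_eq_abs]
        exact ((𝓢.deviation _ ψ' y).le_opNorm₂ w w).trans
          (mul_le_mul_of_nonneg_right (mul_le_mul_of_nonneg_right hdevy (norm_nonneg _)) (norm_nonneg _))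
      have h2 := 𝓢.deviation_apply (boostedKerrBackground Λ c₀ (M i) (a i)) ψ' y w w
      have h3 : (boostedKerrBackground Λ c₀ (M i) (a i)).bilin y.1 w w = -1 - 2 * Kerr.scalarH (M i) (a i) (poincareInv Λ c₀ y.1) := by
        show boostedKerrBilin Λ c₀ (M i) (a i) y.1 _ _ = _
        rw [boostedKerrBilin_apply, hw, ContinuousLinearEquiv.symm_apply_apply, Kerr.bilin_timeVector_timeVector hr]
      have hwn : ‖w‖ ≤ 5 * K := by
        have h := ((Λ : E4 ≃L[ℝ] E4) : E4 →L[ℝ] E4).le_opNorm (Kerr.timeVector (M i) (a i) (poincareInv Λ c₀ y.1))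
        rw [ContinuousLinearEquiv.coe_coe] at h
        have h5 := norm_timeVector_le_w5t hsub hu
        rw [hw]; nlinarith [norm_nonneg (Kerr.timeVector (M i) (a i) (poincareInv Λ c₀ y.1))]
      have h4 : 1 / (100 * K ^ 2) * ‖w‖ * ‖w‖ ≤ 1 / 4 := by
        have h6 : 1 / (100 * K ^ 2) * ‖w‖ * ‖w‖ ≤ 1 / (100 * K ^ 2) * (5 * K) * (5 * K) := by
          have := mul_le_mul hwn hwn (norm_nonneg _) (by positivity)
          have hpos : 0 ≤ 1 / (100 * K ^ 2) := by positivity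
          nlinarith
        rw [show 1 / (100 * K ^ 2) * (5 * K) * (5 * K) = 1 / 4 by field_simp; ring] at h6
        exact h6
      have hH := Kerr.scalarH_nonneg hsub.pos.le (a i) (poincareInv Λ c₀ y.1)
      have h5 := (abs_le.1 h1).2
      rw [h2, h3] at h5
      exact (sub_le_iff_le_add.1 h5).trans_lt (by linarith)
    -- future
    have hmem : Θ i (poincareInv Λ c₀ y.1) ∈ (d.adapted i).domain := hΘm (hsubreg hu)
    have htime : d.toOver.τ₀ < (d.background i).time (recutMap Λ c₀ (Θ i) y.1) := by
      show d.toOver.τ₀ < (poincareInv Λ c₀ ((Λ : E4 ≃L[ℝ] E4) (Θ i (poincareInv Λ c₀ y.1)) + c₀)) 0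
      rw [poincareInv_apply_add]; exact htilt' _ hu (hSlate hyS)
    have key : ∀ p : (d.adapted i).domain, p = ⟨Θ i (poincareInv Λ c₀ y.1), hmem⟩ →
        (d.hole i).timeOrientation.IsFutureDirected (mfderiv 𝓘(ℝ, E4) (𝓡 4) (d.adapted i).toFun p (fderiv ℝ (Θ i)
          (poincareInv Λ c₀ y.1) (Kerr.timeVector (M i) (a i) (poincareInv Λ c₀ y.1)))) := by
      rintro p rfl; exact hF5 i _ hu hmem
    rw [hw, hchain, ContinuousLinearEquiv.symm_apply_apply] at hTL
    have h := hor₂ i ⟨recutMap Λ c₀ (Θ i) y.1, hmaps y.2⟩ _ htime ?_ hTL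
    · rw [hw, hchain, ContinuousLinearEquiv.symm_apply_apply]; exact h
    · rw [ContinuousLinearEquiv.symm_apply_apply]; exact key _ (Subtype.ext (poincareInv_apply_add _ _ _))
  -- conclusion from `junctionTimeFunction_boostedKerr`
  refine ⟨T₁, 1, zero_lt_one, fun γ a' b' hγ hγS s hs t ht hst x hx x' hx' hxT hx'T hxs hx't ↦ ?_⟩
  have hdom : ∀ z ∈ (Kerr.exterior (M i) (a i) : Set E4), (Λ : E4 ≃L[ℝ] E4) z + c₀ ∈ (recutBackground d M a i).domain :=
    fun z hz ↦ by show poincareInv Λ c₀ _ ∈ (Kerr.exterior (M i) (a i) : Set E4); rw [poincareInv_apply_add]; exact hz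
  have hψ'eq : ∀ (z : E4) (hz : z ∈ (Kerr.exterior (M i) (a i) : Set E4))
      (h : (Λ : E4 ≃L[ℝ] E4) (Θ i z) + c₀ ∈ (d.background i).domain),
      ψ' ⟨_, hdom z hz⟩ = d.toOver.chart i ⟨(Λ : E4 ≃L[ℝ] E4) (Θ i z) + c₀, h⟩ := fun z hz h ↦ by
    show d.toOver.chart i ⟨recutMap Λ c₀ (Θ i) ((Λ : E4 ≃L[ℝ] E4) z + c₀), _⟩ = _
    congr 1; apply Subtype.ext
    show (Λ : E4 ≃L[ℝ] E4) (Θ i (poincareInv Λ c₀ ((Λ : E4 ≃L[ℝ] E4) z + c₀))) + c₀ = _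
    rw [poincareInv_apply_add]
  have hmapsγ : MapsTo γ (Icc a' b') (ψ' '' S) := fun u hu ↦ by
    obtain ⟨z, hz, hzT, hzr, h₀, heq⟩ := hγS u hu
    refine ⟨⟨_, hdom z hz⟩, ⟨?_, ?_⟩, ?_⟩
    · show T₁ ≤ (poincareInv Λ c₀ ((Λ : E4 ≃L[ℝ] E4) z + c₀)) 0; rw [poincareInv_apply_add]; exact hzT
    · show Kerr.radius (a i) (poincareInv Λ c₀ ((Λ : E4 ≃L[ℝ] E4) z + c₀)) ≤ _; rw [poincareInv_apply_add]; exact hzr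
    · rw [hψ'eq z hz h₀]; exact heq
  obtain ⟨h₀, hxs⟩ := hxs
  obtain ⟨h₀', hx't⟩ := hx't
  have h := hJTF 𝓢 Λ c₀ (M i) (a i) hsub O τ' ψ' hlate S hSlate hdev hfut γ a' b' hγ hmapsγ s t hs ht hst
    ⟨_, hdom x hx⟩ ⟨_, hdom x' hx'⟩ (by show τ' < (poincareInv Λ c₀ ((Λ : E4 ≃L[ℝ] E4) x + c₀)) 0; rw [poincareInv_apply_add]; linarith)
    (by show τ' < (poincareInv Λ c₀ ((Λ : E4 ≃L[ℝ] E4) x' + c₀)) 0; rw [poincareInv_apply_add]; linarith)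
    (by rw [hψ'eq x hx h₀]; exact hxs) (by rw [hψ'eq x' hx' h₀']; exact hx't)
  have e1 : poincareInv Λ c₀ ((Λ : E4 ≃L[ℝ] E4) x + c₀) = x := poincareInv_apply_add _ _ _
  have e2 : poincareInv Λ c₀ ((Λ : E4 ≃L[ℝ] E4) x' + c₀) = x' := poincareInv_apply_add _ _ _
  simp only [e1, e2] at h
  exact h

end Summit.FinalStateConjecture.FinalStateConjecture.Theorems.SymplecticDualOfTheBomb

end
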